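import Summits.QuantumFields.YangMills.Theorems.UV3AxialLaunderingFreeSlot
import Literature.MathematicalPhysics.QuantumFieldTheory.Balaban1983to89.BlockAveragingHaarAC
import HarnessLib

/-!
# `UV3BranchExpansionReadSetBounds` — the seven PATTERN-INDEPENDENT lattice hypotheses of the amortized covering inequality
# (`hctr`, `hline`, `hdisj`, `hpriv`, `hR`, `hρ`, `hcap` of `UV3BranchExpansionCountingAmortized.sum_pow_card_le_of_discoverable`)
# DISCHARGED for Bałaban's block averaging: segments of `L` bonds, the crossing bond, and the read set of the (0.4) guard
# (crux `UnitScaleTilt.HistoryTailL`, stmt-QuantumFields-19936 — SUPPLY side, record-independent lattice kinematics)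

Cell `ym3-torus` (YM ladder rung R3 = continuum SU(2) Yang–Mills on T³ — a RUNG, NOT d = 4, NOT infinite volume, NOT a mass gap, NOT Clay);
width seat `ym-ust-19936-w5` (gen 19), explicit-unit helper; `--supports stmt-QuantumFields-19936 --as helper`.  THEOREMS ONLY (0 `def`,
0 `sorry`, default heartbeats).

WHAT.  LEAD ★w1-19936 g12's note `Cruxes/HistoryTailL/HTopBranchExpansion.md` (v1.1 §5–§6) reduces the K-uniform top push-forward bound hTop
for the guarded averaging `avT3` to (E)(A)(M) and the count (C′) = ✓`UV3BranchExpansionCountingAmortized.sum_pow_card_le_of_discoverable`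
(w2 g17), an ABSTRACT theorem over bond types `β i` with read sets `R i`, segments `line i` of exactly `L` pairwise-disjoint bonds, a private
crossing bond `ctr i g ∈ line i g`, `|R c| ≤ r₀`, reader multiplicity `≤ ρ₀` and reader CAPACITY `≤ s₀`.  THIS FILE discharges those seven
geometric binders for the MODEL — one blocking step `T^{(j)} → T^{(j+1)}` of lit `Setup`∕`AveragingRT`∕`BlockAveraging` in the standing
range `j + 1 ≤ m + K`, any dimension `P.d`, `L` odd `> 1` — with the segment and the read set HYPOTHESIS-SPECIFIED (no `def`):
`lineF g` = the `L` bonds `line g t`, `t < L` (`hlineF`), and `Rd c` ⊆ the bonds of the loop words of `c` ∪ `c`'s own segment (`hRd`; the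
letters of ✓`BalabanUVNodesN08GuardReadSet`: `∀ i, ∀ s ∈ walk (emb c.src) (loopWord …)` — CONTAINMENT only, so every sub-read-set
qualifies), and `ctr := centralBond`.  Constants (symbolic, no numerals in any statement): **`r₀ = 2·d·L^d`**, **`ρ₀ = 2·d`**,
**`s₀ = (2d − 1)(L − 1)`** (= `162, 6, 10` at `d = L = 3`; the note's memo table used `200, 11, 10`; `s₀` equals dag-n08-d
`N08-HJ-M3-SPEC-g47.md` §1's `(4(d−1)+2)(L−1)/2` WITHOUT the loop-word line-bond census (M3b): block counting suffices).

* §1 ★ `card_lineF` (`= L`) · ★ `disjoint_lineF` · `centralBond_mem_lineF` (= `hline`, `hdisj`, `hctr`; by ✓`UV3AxialLaunderingFreeSlot.line_inj`).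
* §2 ★ `eq_of_centralBond_mem` (= `hpriv`; lit FACT (A) ✓`BlockAveragingHaarAC.eq_of_mem_walk_loopWord_of_eq_centralBond` + `line_inj`) ·
  ★ `blockOf_src_of_mem` ∕ `subset_filter_blockOf` (a read bond issues from `B(c₋) ∪ B(c₊)`: lit `BlockAveraging.blockOf_src_of_mem_walk` +
  `AveragingRT.blockOf_lineSite`) · ★★ `card_readSet_le` (= `hR`; via `#{b : PBond P j | blockOf b.src = y} = d·L^d`, `PBond ≃ Site × Fin d` +
  `Site.card_block`) · `card_filter_src_or_le`, `card_filter_tgt_or_le` (`#{g | g₋ ∈ {y,y′}} ≤ 2d`,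
  `#{g | g₊ ∈ {y,y′}} ≤ 2d`) · ★★ `card_readers_le` (= `hρ`).
* §3 ★★★ **`card_sideSlots_inter_readSet_le`** (= `hcap` VERBATIM: `#(((univ.erase c).biUnion (g ↦ lineF g ∖ {centralBond g})) ∩ Rd c) ≤ (2d−1)(L−1)`):
  a foreign side slot `line g t`, `t ≠ (L−1)/2`, read by `c` issues from `B(c₋) ∪ B(c₊)`; `lineSite_eq_lo∕hi` pin `g₋ ∈ {c₋,c₊}` for the
  `(L−1)/2` low slots and `g₊ ∈ {c₋,c₊}` for the `(L−1)/2` high slots; `g ≠ c` leaves `2d − 1` choices each.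

HOW (F-M1)∕(F-TOP) USE IT: with `β i := PBond P (j+i)` (`j + (i+1) = j+i+1` by `rfl`), `R i := Rd`, `line i := lineF`, `ctr i := centralBond`
at level `j+i`, the seven binders are these theorems at `hj : j+i+1 ≤ m+K` — which holds for `i < n` only (beyond `m + K` the torus has
2 sites per direction and no injective segments), so the abstract count should quantify its geometric binders over `i < n`.

HONEST SCOPE.  [folklore] lattice bookkeeping over lit `Setup`∕`TorusGeometry`∕`AveragingRT`∕`BlockAveraging`∕`BlockAveragingHaarAC`; the
pattern-dependent letters of (C′) (`Dist`, `X`, `N`, towers, `Desc`, the exit chain, «live ⇒ discoverable»), the inclusion `lineF ⊆ Rd` for the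
full loop-word read set, (M), (F-M2), (F-TOP), the numerics are NOT here.  Nothing of hTop, the χ (α) record `AlphaInputsT3ACv4RecChi`, (O‴χₛ),
EX, `HistoryTailL`, the rung R3 is proved; the Yang–Mills mass gap is NOT proved.

References: T. Bałaban, CMP **109** (1987) 249–301 [Balaban1987RG1] ((0.4) p. 253: the guarded block averaging and its loop words);
T. Bałaban, CMP **95** (1984) 17–40 [Balaban1984PropagatorsI] ((1.7) p. 18: the straight contour of `L` bonds); LEAD note
`Cruxes/HistoryTailL/HTopBranchExpansion.md` §5–§6 (2026-08-30); w2 g17 `UV3BranchExpansionCountingAmortized(Letters)`; dag-n08-d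
`N08-HJ-M3-SPEC-g47.md` §1.
-/

set_option autoImplicit false

namespace Summit.QuantumFields.YangMills.Theorems.UV3BranchExpansionReadSetBounds

open Finset
open Literature.MathematicalPhysics.QuantumFieldTheory.Balaban1983to89
open Literature.MathematicalPhysics.QuantumFieldTheory.Balaban1983to89.T4Continuum
open Literature.MathematicalPhysics.QuantumFieldTheory.Balaban1983to89.AveragingRT
open Literature.MathematicalPhysics.QuantumFieldTheory.Balaban1983to89.BlockAveraging
open Literature.MathematicalPhysics.QuantumFieldTheory.Balaban1983to89.BlockAveragingHaarAC
open Summit.QuantumFields.YangMills.Theorems.UV3AxialLaunderingFreeSlot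

variable {P : Params} {j : ℕ} (hj : j + 1 ≤ P.m + P.K)

/-! ## §1 The segment of a coarse bond as a `Finset`: `L` bonds, pairwise disjoint segments, the crossing bond on it -/

section Segment

variable [DecidableEq (PBond P j)]
  (lineF : PBond P (j + 1) → Finset (PBond P j)) (hlineF : ∀ g b, b ∈ lineF g ↔ ∃ t < P.L, b = line g t)
include hlineF

/-- The hypothesis-specified segment is the image of `range L` under `t ↦ line g t`. [folklore] -/
theorem lineF_eq_image (g : PBond P (j + 1)) : lineF g = (Finset.range P.L).image (line g) := by
  ext b
  rw [hlineF, Finset.mem_image]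
  constructor
  · rintro ⟨t, ht, rfl⟩
    exact ⟨t, Finset.mem_range.mpr ht, rfl⟩
  · rintro ⟨t, ht, rfl⟩
    exact ⟨t, Finset.mem_range.mp ht, rfl⟩

include hj

/-- ★ `hline`: **a segment has exactly `L` bonds** (standing range; ✓`line_inj`). [cite: Balaban1984PropagatorsI, (1.7) p.18] -/
theorem card_lineF (g : PBond P (j + 1)) : (lineF g).card = P.L := by
  rw [lineF_eq_image lineF hlineF g, Finset.card_image_of_injOn, Finset.card_range]
  intro t ht t' ht' h
  exact (line_inj hj (Finset.mem_range.mp (Finset.mem_coe.mp ht)) (Finset.mem_range.mp (Finset.mem_coe.mp ht')) h).2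

omit [DecidableEq (PBond P j)] in
/-- ★ `hdisj`: **distinct segments are disjoint** (standing range; ✓`line_inj`). [cite: Balaban1984PropagatorsI, (1.7) p.18] -/
theorem disjoint_lineF {g g' : PBond P (j + 1)} (hne : g ≠ g') : Disjoint (lineF g) (lineF g') := by
  rw [Finset.disjoint_left]
  intro b hb hb'
  obtain ⟨t, ht, rfl⟩ := (hlineF g b).mp hb
  obtain ⟨t', ht', h⟩ := (hlineF g' _).mp hb'
  exact hne (line_inj hj ht ht' h).1

omit hj [DecidableEq (PBond P j)] in
/-- `hctr`: the crossing bond `centralBond g = line g ((L−1)/2)` lies on the segment of `g`. [cite: Balaban1987RG1, (0.4) p.253] -/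
theorem centralBond_mem_lineF (g : PBond P (j + 1)) : centralBond g ∈ lineF g :=
  (hlineF g _).mpr ⟨(P.L - 1) / 2, by have := P.hL.2; omega, rfl⟩

end Segment

/-! ## §2 The read set of the (0.4) guard: privacy of the crossing bond, block support, `|R c| ≤ 2dL^d`, `≤ 2d` readers per bond -/

section ReadSet

variable [DecidableEq (PBond P j)]
  (Rd : PBond P (j + 1) → Finset (PBond P j))
  (hRd : ∀ c b, b ∈ Rd c →
    (∃ i : Idx P, ∃ s ∈ walk (emb c.src) (loopWord P.L c.dir (off i.1) i.2.1 i.2.2), s.bond = b) ∨ ∃ t < P.L, b = line c t)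
include hj hRd

omit [DecidableEq (PBond P j)] in
/-- ★ `hpriv`: **the crossing bond of `g` is read only by `g`** — it is a bond of a loop word of `c` only if `c = g` (lit FACT (A)
✓`eq_of_mem_walk_loopWord_of_eq_centralBond`), and it lies on the segment of `c` only if `c = g` (✓`line_inj`). [cite: Balaban1987RG1, (0.4) p.253] -/
theorem eq_of_centralBond_mem {g c : PBond P (j + 1)} (h : centralBond g ∈ Rd c) : c = g := by
  rcases hRd c _ h with ⟨i, s, hs, hsb⟩ | ⟨t, ht, hct⟩
  · exact (eq_of_mem_walk_loopWord_of_eq_centralBond hj c g i hs hsb).symm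
  · have hL := P.hL.2
    exact (line_inj hj (show (P.L - 1) / 2 < P.L by omega) ht hct).1.symm

omit [DecidableEq (PBond P j)] in
/-- ★ **A read bond issues from one of the two blocks of `c`**: `blockOf b.src ∈ {c₋, c₊}` (lit `blockOf_src_of_mem_walk` for the loop words,
`blockOf_lineSite` for the segment). [cite: Balaban1987RG1, (0.4) p.253] -/
theorem blockOf_src_of_mem {c : PBond P (j + 1)} {b : PBond P j} (hb : b ∈ Rd c) :
    blockOf b.src = c.src ∨ blockOf b.src = c.tgt := by
  rcases hRd c b hb with ⟨i, s, hs, rfl⟩ | ⟨t, ht, rfl⟩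
  · exact blockOf_src_of_mem_walk hj c i s hs
  · exact blockOf_lineSite hj c ht

omit [DecidableEq (PBond P j)] in
/-- The read set of `c` is contained in the bonds issuing from `B(c₋) ∪ B(c₊)`. [cite: Balaban1987RG1, (0.4) p.253] -/
theorem subset_filter_blockOf (c : PBond P (j + 1)) :
    Rd c ⊆ Finset.univ.filter (fun b : PBond P j => blockOf b.src = c.src ∨ blockOf b.src = c.tgt) :=
  fun _ hb => Finset.mem_filter.mpr ⟨Finset.mem_univ _, blockOf_src_of_mem hj Rd hRd hb⟩

/-- ★★ `hR`: **`|R(c)| ≤ 2·d·L^d`** (`= 162` at `d = L = 3`): the read set issues from `B(c₋) ∪ B(c₊)`, and `#{b : PBond P j | b₋ ∈ B(y)} = d·L^d`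
(a positively oriented bond is (initial point, direction), `|B(y)| = L^d` by ✓`Site.card_block`; this count is ✓`Prop7TrueLinDefectBound.card_filter_blockOf_src_eq`
in the Prop-7 lane — re-derived inline here to keep this file's imports inside the averaging kinematics). [cite: Balaban1987RG1, (0.4) p.253] -/
theorem card_readSet_le (c : PBond P (j + 1)) : (Rd c).card ≤ 2 * P.d * P.L ^ P.d := by
  classical
  -- `#{b | blockOf b₋ = y} = d · L^d`
  have hcount : ∀ y : Site P (j + 1), (Finset.univ.filter (fun b : PBond P j => blockOf b.src = y)).card = P.d * P.L ^ P.d := by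
    intro y
    have hset : Finset.univ.filter (fun b : PBond P j => blockOf b.src = y)
        = ((block y) ×ˢ (Finset.univ : Finset (Fin P.d))).image (fun p => (⟨p.1, p.2⟩ : PBond P j)) := by
      ext b
      simp only [Finset.mem_filter, Finset.mem_univ, true_and, Finset.mem_image, Finset.mem_product, and_true, block]
      constructor
      · intro h
        exact ⟨(b.src, b.dir), h, rfl⟩
      · rintro ⟨p, hp, rfl⟩
        exact hp
    have hinj : Function.Injective (fun p : Site P j × Fin P.d => (⟨p.1, p.2⟩ : PBond P j)) := by
      intro p q h
      simp only [PBond.mk.injEq] at h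
      exact Prod.ext h.1 h.2
    rw [hset, Finset.card_image_of_injective _ hinj, Finset.card_product, Site.card_block hj, Finset.card_univ,
      Fintype.card_fin, mul_comm]
  calc (Rd c).card
      ≤ (Finset.univ.filter (fun b : PBond P j => blockOf b.src = c.src ∨ blockOf b.src = c.tgt)).card :=
        Finset.card_le_card (subset_filter_blockOf hj Rd hRd c)
    _ ≤ (Finset.univ.filter (fun b : PBond P j => blockOf b.src = c.src)).card
          + (Finset.univ.filter (fun b : PBond P j => blockOf b.src = c.tgt)).card := by
        rw [Finset.filter_or]
        exact Finset.card_union_le _ _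
    _ = 2 * P.d * P.L ^ P.d := by
        rw [hcount, hcount]
        ring

omit hj hRd [DecidableEq (PBond P j)] in
/-- `#{g : PBond P (j+1) | g₋ = y ∨ g₋ = y′} ≤ 2d` (at most `d` bonds issue from a site). [folklore] -/
theorem card_filter_src_or_le [DecidableEq (PBond P (j + 1))] (y y' : Site P (j + 1)) :
    (Finset.univ.filter (fun g : PBond P (j + 1) => g.src = y ∨ g.src = y')).card ≤ 2 * P.d := by
  have hsub : Finset.univ.filter (fun g : PBond P (j + 1) => g.src = y ∨ g.src = y')
      ⊆ (Finset.univ : Finset (Fin P.d)).image (fun μ => (⟨y, μ⟩ : PBond P (j + 1)))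
        ∪ (Finset.univ : Finset (Fin P.d)).image (fun μ => (⟨y', μ⟩ : PBond P (j + 1))) := by
    intro g hg
    rcases (Finset.mem_filter.mp hg).2 with h | h
    · exact Finset.mem_union_left _ (Finset.mem_image.mpr ⟨g.dir, Finset.mem_univ _, by cases g; cases h; rfl⟩)
    · exact Finset.mem_union_right _ (Finset.mem_image.mpr ⟨g.dir, Finset.mem_univ _, by cases g; cases h; rfl⟩)
  calc _ ≤ _ := Finset.card_le_card hsub
    _ ≤ _ := Finset.card_union_le _ _
    _ ≤ P.d + P.d := Nat.add_le_add
        (Finset.card_image_le.trans (by rw [Finset.card_univ, Fintype.card_fin]))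
        (Finset.card_image_le.trans (by rw [Finset.card_univ, Fintype.card_fin]))
    _ = 2 * P.d := by ring

omit hj hRd [DecidableEq (PBond P j)] in
/-- `#{g : PBond P (j+1) | g₊ = y ∨ g₊ = y′} ≤ 2d` (at most `d` bonds end at a site: `g₋ = g₊ − e_{dir g}`). [folklore] -/
theorem card_filter_tgt_or_le [DecidableEq (PBond P (j + 1))] (y y' : Site P (j + 1)) :
    (Finset.univ.filter (fun g : PBond P (j + 1) => g.tgt = y ∨ g.tgt = y')).card ≤ 2 * P.d := by
  have key : ∀ (g : PBond P (j + 1)) (z : Site P (j + 1)), g.tgt = z → g = ⟨z.unshift g.dir, g.dir⟩ := by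
    intro g z h
    have hs : g.src = z.unshift g.dir := by
      rw [← h]
      exact (Site.unshift_shift g.src g.dir).symm
    cases g
    simp only at hs
    simp only [hs]
  have hsub : Finset.univ.filter (fun g : PBond P (j + 1) => g.tgt = y ∨ g.tgt = y')
      ⊆ (Finset.univ : Finset (Fin P.d)).image (fun μ => (⟨y.unshift μ, μ⟩ : PBond P (j + 1)))
        ∪ (Finset.univ : Finset (Fin P.d)).image (fun μ => (⟨y'.unshift μ, μ⟩ : PBond P (j + 1))) := by
    intro g hg
    rcases (Finset.mem_filter.mp hg).2 with h | h
    · exact Finset.mem_union_left _ (Finset.mem_image.mpr ⟨g.dir, Finset.mem_univ _, (key g y h).symm⟩)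
    · exact Finset.mem_union_right _ (Finset.mem_image.mpr ⟨g.dir, Finset.mem_univ _, (key g y' h).symm⟩)
  calc _ ≤ _ := Finset.card_le_card hsub
    _ ≤ _ := Finset.card_union_le _ _
    _ ≤ P.d + P.d := Nat.add_le_add
        (Finset.card_image_le.trans (by rw [Finset.card_univ, Fintype.card_fin]))
        (Finset.card_image_le.trans (by rw [Finset.card_univ, Fintype.card_fin]))
    _ = 2 * P.d := by ring

/-- ★★ `hρ`: **every fine bond is read by at most `2d` coarse bonds** (`= 6` at `d = 3`): a reader `c` of `b` has `blockOf b₋ ∈ {c₋, c₊}`,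
i.e. `c` issues from or ends at the block of `b`. [cite: Balaban1987RG1, (0.4) p.253] -/
theorem card_readers_le [DecidableEq (PBond P (j + 1))] (b : PBond P j) :
    (Finset.univ.filter (fun c : PBond P (j + 1) => b ∈ Rd c)).card ≤ 2 * P.d := by
  have hsub : Finset.univ.filter (fun c : PBond P (j + 1) => b ∈ Rd c)
      ⊆ Finset.univ.filter (fun c : PBond P (j + 1) => c.src = blockOf b.src ∨ c.src = (blockOf b.src).unshift c.dir) := by
    intro c hc
    refine Finset.mem_filter.mpr ⟨Finset.mem_univ _, ?_⟩
    rcases blockOf_src_of_mem hj Rd hRd (Finset.mem_filter.mp hc).2 with h | h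
    · exact Or.inl h.symm
    · right
      rw [h]
      exact (Site.unshift_shift c.src c.dir).symm
  have hsub' : Finset.univ.filter (fun c : PBond P (j + 1) => c.src = blockOf b.src ∨ c.src = (blockOf b.src).unshift c.dir)
      ⊆ (Finset.univ : Finset (Fin P.d)).image (fun μ => (⟨blockOf b.src, μ⟩ : PBond P (j + 1)))
        ∪ (Finset.univ : Finset (Fin P.d)).image (fun μ => (⟨(blockOf b.src).unshift μ, μ⟩ : PBond P (j + 1))) := by
    intro c hc
    rcases (Finset.mem_filter.mp hc).2 with h | h
    · exact Finset.mem_union_left _ (Finset.mem_image.mpr ⟨c.dir, Finset.mem_univ _, by cases c; cases h; rfl⟩)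
    · refine Finset.mem_union_right _ (Finset.mem_image.mpr ⟨c.dir, Finset.mem_univ _, ?_⟩)
      cases c
      simp only at h
      simp only [h]
  calc _ ≤ _ := Finset.card_le_card (hsub.trans hsub')
    _ ≤ _ := Finset.card_union_le _ _
    _ ≤ P.d + P.d := Nat.add_le_add
        (Finset.card_image_le.trans (by rw [Finset.card_univ, Fintype.card_fin]))
        (Finset.card_image_le.trans (by rw [Finset.card_univ, Fintype.card_fin]))
    _ = 2 * P.d := by ring

end ReadSet

/-! ## §3 The reader CAPACITY `hcap`: a read set contains side slots of at most `(2d − 1)(L − 1)` foreign segment positions -/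

section Capacity

variable [DecidableEq (PBond P j)] [DecidableEq (PBond P (j + 1))]
  (lineF : PBond P (j + 1) → Finset (PBond P j)) (hlineF : ∀ g b, b ∈ lineF g ↔ ∃ t < P.L, b = line g t)
  (Rd : PBond P (j + 1) → Finset (PBond P j))
  (hRd : ∀ c b, b ∈ Rd c →
    (∃ i : Idx P, ∃ s ∈ walk (emb c.src) (loopWord P.L c.dir (off i.1) i.2.1 i.2.2), s.bond = b) ∨ ∃ t < P.L, b = line c t)
include hj hlineF hRd

/-- ★★★ `hcap`: **THE READER CAPACITY** — the side slots (segment bonds other than the crossing bond) of the segments `g ≠ c` that the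
guard of `c` reads number at most `(2d − 1)(L − 1)` (`= 10` at `d = L = 3`, dag-n08-d M3-SPEC §1's `(4(d−1)+2)(L−1)/2`).  Proof by BLOCK
COUNTING (no loop-word census): such a slot `line g t` issues from `B(c₋) ∪ B(c₊)`; for the `(L−1)/2` low positions `t < (L−1)/2` that block is
`B(g₋)` (`lineSite_eq_lo`), for the `(L−1)/2` high positions it is `B(g₊)` (`lineSite_eq_hi`); so `g₋ ∈ {c₋,c₊}` resp. `g₊ ∈ {c₋,c₊}`, `2d` bonds
each, minus `c` itself. [cite: Balaban1987RG1, (0.4) p.253] -/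
theorem card_sideSlots_inter_readSet_le (c : PBond P (j + 1)) :
    (((Finset.univ.erase c).biUnion (fun g => (lineF g).erase (centralBond g))) ∩ Rd c).card ≤ (2 * P.d - 1) * (P.L - 1) := by
  have hL := P.hL.2
  have hhalf : 2 * ((P.L - 1) / 2) + 1 = P.L := two_mul_half_add_one P
  -- the two index sets: (foreign segment with the right end block) × (half of the positions)
  set A : Finset (PBond P (j + 1)) :=
    (Finset.univ.filter (fun g : PBond P (j + 1) => g.src = c.src ∨ g.src = c.tgt)).erase c with hA
  set B : Finset (PBond P (j + 1)) :=
    (Finset.univ.filter (fun g : PBond P (j + 1) => g.tgt = c.src ∨ g.tgt = c.tgt)).erase c with hB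
  set H : Finset ℕ := Finset.range ((P.L - 1) / 2) with hH
  set Dom : Finset (PBond P j) :=
    (A ×ˢ H).image (fun p => line p.1 p.2) ∪ (B ×ˢ H).image (fun p => line p.1 ((P.L + 1) / 2 + p.2)) with hDom
  -- cardinalities of the index sets
  have hcA : A.card ≤ 2 * P.d - 1 := by
    have hc : c ∈ Finset.univ.filter (fun g : PBond P (j + 1) => g.src = c.src ∨ g.src = c.tgt) :=
      Finset.mem_filter.mpr ⟨Finset.mem_univ _, Or.inl rfl⟩
    rw [hA, Finset.card_erase_of_mem hc]
    exact Nat.sub_le_sub_right (card_filter_src_or_le c.src c.tgt) 1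
  have hcB : B.card ≤ 2 * P.d - 1 := by
    have hc : c ∈ Finset.univ.filter (fun g : PBond P (j + 1) => g.tgt = c.src ∨ g.tgt = c.tgt) :=
      Finset.mem_filter.mpr ⟨Finset.mem_univ _, Or.inr rfl⟩
    rw [hB, Finset.card_erase_of_mem hc]
    exact Nat.sub_le_sub_right (card_filter_tgt_or_le c.src c.tgt) 1
  have hcH : H.card = (P.L - 1) / 2 := Finset.card_range _
  -- the containment
  have hsub : ((Finset.univ.erase c).biUnion (fun g => (lineF g).erase (centralBond g))) ∩ Rd c ⊆ Dom := by
    intro b hb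
    obtain ⟨hb1, hb2⟩ := Finset.mem_inter.mp hb
    obtain ⟨g, hg, hbg⟩ := Finset.mem_biUnion.mp hb1
    have hgc : g ≠ c := Finset.ne_of_mem_erase hg
    obtain ⟨hbctr, hbl⟩ := Finset.mem_erase.mp hbg
    obtain ⟨t, ht, rfl⟩ := (hlineF g b).mp hbl
    have htmid : t ≠ (P.L - 1) / 2 := fun h => hbctr (by rw [h]; rfl)
    have hblk : blockOf (lineSite g t) = c.src ∨ blockOf (lineSite g t) = c.tgt := blockOf_src_of_mem hj Rd hRd hb2
    rw [hDom, Finset.mem_union]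
    by_cases hlo : t < (P.L - 1) / 2
    · -- low half: the slot issues from `B(g₋)`
      left
      have hsrc : blockOf (lineSite g t) = g.src := by
        rw [lineSite_eq_lo hj g hlo.le, Site.blockOf_blockSite hj]
      rw [hsrc] at hblk
      refine Finset.mem_image.mpr ⟨(g, t), Finset.mem_product.mpr ⟨?_, Finset.mem_range.mpr hlo⟩, rfl⟩
      exact Finset.mem_erase.mpr ⟨hgc, Finset.mem_filter.mpr ⟨Finset.mem_univ _, hblk⟩⟩
    · -- high half: the slot issues from `B(g₊)`
      right
      have hgt : (P.L - 1) / 2 < t := by omega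
      have htgt : blockOf (lineSite g t) = g.tgt := by
        rw [lineSite_eq_hi hj g hgt ht.le, Site.blockOf_blockSite hj]
      rw [htgt] at hblk
      refine Finset.mem_image.mpr ⟨(g, t - (P.L + 1) / 2), Finset.mem_product.mpr ⟨?_, Finset.mem_range.mpr (by omega)⟩, ?_⟩
      · exact Finset.mem_erase.mpr ⟨hgc, Finset.mem_filter.mpr ⟨Finset.mem_univ _, hblk⟩⟩
      · show line g ((P.L + 1) / 2 + (t - (P.L + 1) / 2)) = line g t
        congr 1
        omega
  -- count
  calc (((Finset.univ.erase c).biUnion (fun g => (lineF g).erase (centralBond g))) ∩ Rd c).card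
      ≤ Dom.card := Finset.card_le_card hsub
    _ ≤ ((A ×ˢ H).image (fun p => line p.1 p.2)).card + ((B ×ˢ H).image (fun p => line p.1 ((P.L + 1) / 2 + p.2))).card :=
        Finset.card_union_le _ _
    _ ≤ (A ×ˢ H).card + (B ×ˢ H).card := Nat.add_le_add Finset.card_image_le Finset.card_image_le
    _ = A.card * ((P.L - 1) / 2) + B.card * ((P.L - 1) / 2) := by rw [Finset.card_product, Finset.card_product, hcH]
    _ ≤ (2 * P.d - 1) * ((P.L - 1) / 2) + (2 * P.d - 1) * ((P.L - 1) / 2) :=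
        Nat.add_le_add (Nat.mul_le_mul_right _ hcA) (Nat.mul_le_mul_right _ hcB)
    _ = (2 * P.d - 1) * (P.L - 1) := by
        rw [← Nat.mul_add, ← two_mul]
        congr 1
        omega

end Capacity

end Summit.QuantumFields.YangMills.Theorems.UV3BranchExpansionReadSetBounds
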